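import Mathlib
import Summits.RiemannHypothesis.RiemannHypothesis.Theorems.IntegerScrewExitDensity
import Summits.RiemannHypothesis.RiemannHypothesis.Theorems.IntegerScrewExitTilt
import HarnessLib

/-!
# Route `IntegerScrew` — THEOREM B's flattened density: `b·ν^𝒜(b) + L/log(bp)` is constant up to `O(1)`
# (CONTINUUM-LIMIT §25.10 (b)/(e) in the kernel: the χ² term of `window_functional_sq_le_atom_tilt`)

THEOREM B's cell (`3 ≤ p`, `2p ≤ R < p²`, `Q = R/p`, atom `𝒜` = `p`-free numbers, bottom `B = [1, Q]` — every
`b ≤ Q < p` is `p`-free).  The atom's exit density is `b·ν^𝒜(b) = b·ν(b) − τ(b)` (`exitTilt`); the all-integer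
density is flat, `B·L·L₀ ≤ b·ν(b) ≤ A·L·U₀` (`le_mul_exitInflow`, `mul_exitInflow_le`), and the tilt is
`τ(b) = L/log(bp) + O(1)` from both sides (`exitTilt_le`, `le_exitTilt`).  Hence with the PROFILE
`T(b) = L/(log b + log p)` the flattened density `x_b := b·ν^𝒜(b) + T(b)` lies in a `b`-INDEPENDENT interval:

* `bottom_filter_eq` — `(Icc 1 (R/p)).filter (p-free) = Icc 1 (R/p)` when `R < p²`;
* **`flatDensity_le` / `le_flatDensity`** — `m_lo ≤ x_b ≤ m_hi` for `1 ≤ b ≤ R/p`, with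
  `m_hi = A·L·U₀ + (1 − B)·L/log p + B + B·L·c/log²(p−1)`,
  `m_lo = B·L·L₀ + A − (A − 1)·L/log(p−1) − L·(log p − log(p−1))/log²(p−1) − A·L·c/log²(p−1)`
  (`c = E_lo + E_hi` the prime Mertens constants, `U₀, L₀` the constants of `IntegerScrewExitDensity` at `Q = R/p`);
* **`flat_chiSq_le`** — the flattened χ² of `window_functional_sq_le_atom_tilt` with this profile is
  `≤ H_Q·(m_hi − m_lo)²`.
With `A − 1, 1 − B = O(1/((1−δ)²L))` and `A·U₀·L − B·L₀·L = O(L/log²Q) + O((A−B)L/log Q)` this is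
`H_Q·O(1/log²Q + c²u²/λ²)` — the analogue of `exitChiSq_le` for the true cell (25.10 (e)).

RH-free, elementary.  Nothing in this file bears on the truth of RH.
References: CONTINUUM-LIMIT §25.10 (rh-explicit A6-PIVOT); M. Suzuki, J. Lond. Math. Soc. (2) 108 (2023)
1448–1487 [Suzuki2023].
-/

noncomputable section

set_option linter.dupNamespace false -- D-0017: `Summit.<S>.<S>.…` is the designed namespace

namespace Summit.RiemannHypothesis.RiemannHypothesis.Theorems.IntegerScrew

open Finset Real
open ArithmeticFunction (vonMangoldt)

/-! ### The bottom is all of `[1, R/p]` -/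

/-- For `R < p²` every `b ≤ R/p` is `< p`, hence `p`-free. -/
theorem bottom_filter_eq {R p : ℕ} (hp : 1 ≤ p) (hR : R < p ^ 2) :
    (Icc 1 (R / p)).filter (· ∈ Nat.smoothNumbers p) = Icc 1 (R / p) := by
  refine Finset.filter_true_of_mem fun b hb => ?_
  have hb' := Finset.mem_Icc.1 hb
  have hQp : R / p < p := (Nat.div_lt_iff_lt_mul (by omega)).2 (by nlinarith)
  exact smooth_of_lt hb'.1 (lt_of_le_of_lt hb'.2 hQp)

/-! ### The flattened density from above and below -/

/-- **Upper bound**: `b·ν^𝒜(b) + L/(log b + log p) ≤ m_hi` for `1 ≤ b ≤ R/p` (hypotheses of `mul_exitInflow_le`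
at `Q = R/p` and of `le_exitTilt`: the pointwise two-sided Green bounds `B log R/log x ≤ Γ ≤ A log R/log x` on
`(R/p, R]` with `0 ≤ B ≤ 1 ≤ A`, the lower Mertens constant `c′` for `Λ`, the prime Mertens constants `E_lo, E_hi`). -/
theorem flatDensity_le {R p : ℕ} (hp : 3 ≤ p) (hpR : 2 * p ≤ R) (hR : R < p ^ 2) {A B c' Elo Ehi : ℝ}
    (hA1 : 1 ≤ A) (hΓU : ∀ x, R / p < x → x ≤ R → exitGamma R (R / p) x ≤ A * Real.log R / Real.log x)
    (hB0 : 0 ≤ B) (hB1 : B ≤ 1)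
    (hΓL : ∀ x, R / p < x → x ≤ R → B * Real.log R / Real.log x ≤ exitGamma R (R / p) x)
    (hψ : ∀ n, 1 ≤ n → n ≤ R → Real.log n - c' ≤ ∑ k ∈ Icc 1 n, vonMangoldt k / k)
    (hhi : ∀ n : ℕ, 1 ≤ n → ∑ k ∈ Icc 1 n, primeLogDiv k ≤ Real.log n + Ehi)
    (hlo : ∀ n : ℕ, 1 ≤ n → Real.log n - Elo ≤ ∑ k ∈ Icc 1 n, primeLogDiv k)
    {b : ℕ} (hb : 1 ≤ b) (hbQ : b ≤ R / p) :
    (b : ℝ) * exitInflowAtom R (R / p) p b + Real.log R / (Real.log b + Real.log p) ≤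
      A * Real.log R * (1 / Real.log (((R / p : ℕ) : ℝ) + 1) - 1 / Real.log R +
          (39 / 50 + c' + 2 * Real.log 2) / Real.log (((R / p : ℕ) : ℝ) + 1) ^ 2) +
        (1 - B) * Real.log R / Real.log p + B +
        B * Real.log R * (Elo + Ehi) / Real.log ((p - 1 : ℕ) : ℝ) ^ 2 := by
  have hp1 : 1 ≤ p := by omega
  have hQ2 : 2 ≤ R / p := (Nat.le_div_iff_mul_le (by omega)).2 (by linarith)
  have hQR : 2 * (R / p) ≤ R := by
    have := Nat.div_mul_le_self R p
    have : 2 * (R / p) ≤ p * (R / p) := Nat.mul_le_mul_right _ (by omega)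
    nlinarith [Nat.div_mul_le_self R p, mul_comm p (R / p)]
  have hpRb : p ≤ R / b := (Nat.le_div_iff_mul_le (by omega)).2
    (by have := (Nat.le_div_iff_mul_le (by omega)).1 hbQ; rw [mul_comm]; exact le_trans (by rw [mul_comm]) this)
  have hpR : p ≤ R := le_trans (by omega) hpR
  have hR3 : 3 ≤ R := le_trans hp hpR
  -- the two ingredients
  have hν := mul_exitInflow_le hb hbQ hQR hA1 hΓU hψ
  have hτ := le_exitTilt hp hR hB0 hΓL hhi hlo hb hpRb
  -- x = bν − τ + L/log(bp)
  have hx : (b : ℝ) * exitInflowAtom R (R / p) p b = (b : ℝ) * exitInflow R (R / p) b - exitTilt R p b := by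
    unfold exitTilt; ring
  rw [hx]
  -- elementary facts
  set L := Real.log R with hL
  have hL0 : 0 < L := Real.log_pos (by exact_mod_cast (show 1 < R by omega))
  have hlogp : 0 < Real.log p := Real.log_pos (by exact_mod_cast (show 1 < p by omega))
  have hlogb : 0 ≤ Real.log b := Real.log_natCast_nonneg b
  have hlam1 : 0 < Real.log ((p - 1 : ℕ) : ℝ) := by
    have : (2 : ℝ) ≤ ((p - 1 : ℕ) : ℝ) := by exact_mod_cast (show 2 ≤ p - 1 by omega)
    exact Real.log_pos (by linarith)
  have hc : 0 ≤ Elo + Ehi := mertens_consts_nonneg hhi hlo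
  -- the b-dependent pieces against their worst cases
  have e1 : (1 - B) * L / (Real.log b + Real.log p) ≤ (1 - B) * L / Real.log p := by
    refine div_le_div_of_nonneg_left (mul_nonneg (by linarith) hL0.le) hlogp (by linarith)
  have e2 : B * L * (1 / (Real.log b + Real.log ((R / b + 1 : ℕ) : ℝ))) ≤ B := by
    have hgt : L ≤ Real.log b + Real.log ((R / b + 1 : ℕ) : ℝ) := by
      rw [← Real.log_mul (by exact_mod_cast (show b ≠ 0 by omega)) (by positivity), hL]
      refine Real.log_le_log (by positivity) ?_
      have : R < b * (R / b + 1) := by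
        have := Nat.lt_div_mul_add (a := R) (b := b) (by omega)
        rw [mul_comm] at this; linarith [this]
      exact_mod_cast this.le
    have hpos : 0 < Real.log b + Real.log ((R / b + 1 : ℕ) : ℝ) := by linarith
    calc B * L * (1 / (Real.log b + Real.log ((R / b + 1 : ℕ) : ℝ)))
        = B * (L / (Real.log b + Real.log ((R / b + 1 : ℕ) : ℝ))) := by ring
      _ ≤ B * 1 := mul_le_mul_of_nonneg_left ((div_le_one hpos).2 hgt) hB0
      _ = B := mul_one B
  have e3 : B * L * ((Elo + Ehi) * (1 / (Real.log b + Real.log ((p - 1 : ℕ) : ℝ)) ^ 2)) ≤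
      B * L * (Elo + Ehi) / Real.log ((p - 1 : ℕ) : ℝ) ^ 2 := by
    have hden : Real.log ((p - 1 : ℕ) : ℝ) ^ 2 ≤ (Real.log b + Real.log ((p - 1 : ℕ) : ℝ)) ^ 2 := by
      nlinarith
    have : 1 / (Real.log b + Real.log ((p - 1 : ℕ) : ℝ)) ^ 2 ≤ 1 / Real.log ((p - 1 : ℕ) : ℝ) ^ 2 :=
      one_div_le_one_div_of_le (by positivity) hden
    calc B * L * ((Elo + Ehi) * (1 / (Real.log b + Real.log ((p - 1 : ℕ) : ℝ)) ^ 2))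
        ≤ B * L * ((Elo + Ehi) * (1 / Real.log ((p - 1 : ℕ) : ℝ) ^ 2)) :=
          mul_le_mul_of_nonneg_left (mul_le_mul_of_nonneg_left this hc) (by positivity)
      _ = B * L * (Elo + Ehi) / Real.log ((p - 1 : ℕ) : ℝ) ^ 2 := by ring
  have e4 : -(B * L * (1 / (Real.log b + Real.log p))) + L / (Real.log b + Real.log p) =
      (1 - B) * L / (Real.log b + Real.log p) := by ring
  nlinarith [hν, hτ, e1, e2, e3, e4]

/-- **Lower bound**: `m_lo ≤ b·ν^𝒜(b) + L/(log b + log p)` for `1 ≤ b ≤ R/p`. -/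
theorem le_flatDensity {R p : ℕ} (hp : 3 ≤ p) (hpR : 2 * p ≤ R) (hR : R < p ^ 2) {A B c' Elo Ehi : ℝ}
    (hA1 : 1 ≤ A) (hΓU : ∀ x, R / p < x → x ≤ R → exitGamma R (R / p) x ≤ A * Real.log R / Real.log x)
    (hB0 : 0 ≤ B)
    (hΓL : ∀ x, R / p < x → x ≤ R → B * Real.log R / Real.log x ≤ exitGamma R (R / p) x)
    (hψ : ∀ n, 1 ≤ n → n ≤ R → Real.log n - c' ≤ ∑ k ∈ Icc 1 n, vonMangoldt k / k)
    (hhi : ∀ n : ℕ, 1 ≤ n → ∑ k ∈ Icc 1 n, primeLogDiv k ≤ Real.log n + Ehi)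
    (hlo : ∀ n : ℕ, 1 ≤ n → Real.log n - Elo ≤ ∑ k ∈ Icc 1 n, primeLogDiv k)
    {b : ℕ} (hb : 1 ≤ b) (hbQ : b ≤ R / p) :
    B * Real.log R * (1 / Real.log (2 * ((R / p : ℕ) : ℝ)) - 1 / (Real.log R - Real.log 2) -
          (39 / 50 + c' + Real.log 2) / Real.log (((R / p : ℕ) : ℝ) + 1) ^ 2) +
        A - (A - 1) * Real.log R / Real.log ((p - 1 : ℕ) : ℝ) -
        Real.log R * (Real.log p - Real.log ((p - 1 : ℕ) : ℝ)) / Real.log ((p - 1 : ℕ) : ℝ) ^ 2 -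
        A * Real.log R * (Elo + Ehi) / Real.log ((p - 1 : ℕ) : ℝ) ^ 2 ≤
      (b : ℝ) * exitInflowAtom R (R / p) p b + Real.log R / (Real.log b + Real.log p) := by
  have hp1 : 1 ≤ p := by omega
  have hQ2 : 2 ≤ R / p := (Nat.le_div_iff_mul_le (by omega)).2 (by linarith)
  have hQR : 2 * (R / p) ≤ R := by
    nlinarith [Nat.div_mul_le_self R p, mul_comm p (R / p), Nat.mul_le_mul_right (R / p) (show 2 ≤ p by omega)]
  have hpRb : p ≤ R / b := (Nat.le_div_iff_mul_le (by omega)).2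
    (by have := (Nat.le_div_iff_mul_le (by omega)).1 hbQ; rw [mul_comm]; exact le_trans (by rw [mul_comm]) this)
  have hpR : p ≤ R := le_trans (by omega) hpR
  have hν := le_mul_exitInflow hb hbQ hQ2 hQR hB0 hψ hΓL
  have hτ := exitTilt_le hp hR hA1 hΓU hhi hlo hb hpRb
  have hx : (b : ℝ) * exitInflowAtom R (R / p) p b = (b : ℝ) * exitInflow R (R / p) b - exitTilt R p b := by
    unfold exitTilt; ring
  rw [hx]
  set L := Real.log R with hL
  have hL0 : 0 < L := Real.log_pos (by exact_mod_cast (show 1 < R by omega))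
  have hlogp : 0 < Real.log p := Real.log_pos (by exact_mod_cast (show 1 < p by omega))
  have hlogb : 0 ≤ Real.log b := Real.log_natCast_nonneg b
  have hlam1 : 0 < Real.log ((p - 1 : ℕ) : ℝ) := by
    have : (2 : ℝ) ≤ ((p - 1 : ℕ) : ℝ) := by exact_mod_cast (show 2 ≤ p - 1 by omega)
    exact Real.log_pos (by linarith)
  have hlam1p : Real.log ((p - 1 : ℕ) : ℝ) ≤ Real.log p :=
    Real.log_le_log (by exact_mod_cast (show 0 < p - 1 by omega)) (by exact_mod_cast (Nat.sub_le p 1))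
  have hc : 0 ≤ Elo + Ehi := mertens_consts_nonneg hhi hlo
  have hAL : 0 ≤ A * L := mul_nonneg (by linarith) hL0.le
  -- A L/(log b + log⌊R/b⌋) ≥ A
  have e1 : A ≤ A * L * (1 / (Real.log b + Real.log ((R / b : ℕ) : ℝ))) := by
    have hRb3 : 3 ≤ R / b := le_trans hp hpRb
    have hpos : 0 < Real.log b + Real.log ((R / b : ℕ) : ℝ) := by
      have : 0 < Real.log ((R / b : ℕ) : ℝ) := Real.log_pos (by exact_mod_cast (show 1 < R / b by omega))
      linarith
    have hle : Real.log b + Real.log ((R / b : ℕ) : ℝ) ≤ L := by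
      rw [← Real.log_mul (by exact_mod_cast (show b ≠ 0 by omega)) (by positivity), hL]
      refine Real.log_le_log (by positivity) ?_
      exact_mod_cast (by rw [mul_comm]; exact Nat.div_mul_le_self R b : b * (R / b) ≤ R)
    have : 1 ≤ L * (1 / (Real.log b + Real.log ((R / b : ℕ) : ℝ))) := by
      rw [mul_one_div, le_div_iff₀ hpos]; linarith
    calc A = A * 1 := (mul_one A).symm
      _ ≤ A * (L * (1 / (Real.log b + Real.log ((R / b : ℕ) : ℝ)))) := mul_le_mul_of_nonneg_left this (by linarith)
      _ = _ := by ring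
  -- −A L/λ_b + L/log(bp) ≥ −(A−1)L/λ₁ − L(log p − λ₁)/λ₁²
  have e2 : -((A - 1) * L / Real.log ((p - 1 : ℕ) : ℝ)) -
      L * (Real.log p - Real.log ((p - 1 : ℕ) : ℝ)) / Real.log ((p - 1 : ℕ) : ℝ) ^ 2 ≤
      -(A * L * (1 / (Real.log b + Real.log ((p - 1 : ℕ) : ℝ)))) + L / (Real.log b + Real.log p) := by
    set lb := Real.log b + Real.log ((p - 1 : ℕ) : ℝ) with hlb
    set lp := Real.log b + Real.log p with hlp
    have hlb0 : 0 < lb := by rw [hlb]; linarith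
    have hlp0 : 0 < lp := by rw [hlp]; linarith
    have hlbp : lb ≤ lp := by rw [hlb, hlp]; linarith
    -- (A−1)L/lb ≤ (A−1)L/λ₁ and L(1/lb − 1/lp) = L(lp − lb)/(lb lp) ≤ L (log p − λ₁)/λ₁²
    have f1 : (A - 1) * L / lb ≤ (A - 1) * L / Real.log ((p - 1 : ℕ) : ℝ) :=
      div_le_div_of_nonneg_left (mul_nonneg (by linarith) hL0.le) hlam1 (by rw [hlb]; linarith)
    have f2 : L * (1 / lb - 1 / lp) ≤ L * (Real.log p - Real.log ((p - 1 : ℕ) : ℝ)) / Real.log ((p - 1 : ℕ) : ℝ) ^ 2 := by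
      have hd : 1 / lb - 1 / lp = (lp - lb) / (lb * lp) := by field_simp
      have hnum : lp - lb = Real.log p - Real.log ((p - 1 : ℕ) : ℝ) := by rw [hlp, hlb]; ring
      rw [hd, hnum, mul_div_assoc]
      refine mul_le_mul_of_nonneg_left ?_ hL0.le
      refine div_le_div_of_nonneg_left (by linarith) (by positivity) ?_
      nlinarith
    have : -(A * L * (1 / lb)) + L / lp = -((A - 1) * L / lb) - L * (1 / lb - 1 / lp) := by ring
    rw [this]
    linarith
  -- −A L c/λ_b² ≥ −A L c/λ₁²
  have e3 : A * L * ((Elo + Ehi) * (1 / (Real.log b + Real.log ((p - 1 : ℕ) : ℝ)) ^ 2)) ≤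
      A * L * (Elo + Ehi) / Real.log ((p - 1 : ℕ) : ℝ) ^ 2 := by
    have hden : Real.log ((p - 1 : ℕ) : ℝ) ^ 2 ≤ (Real.log b + Real.log ((p - 1 : ℕ) : ℝ)) ^ 2 := by nlinarith
    have : 1 / (Real.log b + Real.log ((p - 1 : ℕ) : ℝ)) ^ 2 ≤ 1 / Real.log ((p - 1 : ℕ) : ℝ) ^ 2 :=
      one_div_le_one_div_of_le (by positivity) hden
    calc A * L * ((Elo + Ehi) * (1 / (Real.log b + Real.log ((p - 1 : ℕ) : ℝ)) ^ 2))
        ≤ A * L * ((Elo + Ehi) * (1 / Real.log ((p - 1 : ℕ) : ℝ) ^ 2)) :=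
          mul_le_mul_of_nonneg_left (mul_le_mul_of_nonneg_left this hc) hAL
      _ = _ := by ring
  nlinarith [hν, hτ, e1, e2, e3]

/-! ### The flattened χ² -/

/-- Values in an interval have weighted mean in the interval and deviations at most its length:
if `m_lo ≤ x b ≤ m_hi` on `[1, Q]` then `Σ_{b≤Q} (1/b)(x b − x̄)² ≤ H_Q·(m_hi − m_lo)²`, `x̄ = (Σ x b/b)/H_Q`. -/
theorem sum_inv_mul_sq_sub_mean_le {Q : ℕ} (hQ : 1 ≤ Q) {x : ℕ → ℝ} {mlo mhi : ℝ}
    (hx : ∀ b, 1 ≤ b → b ≤ Q → mlo ≤ x b ∧ x b ≤ mhi) :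
    ∑ b ∈ Icc 1 Q, (1 / (b : ℝ)) * (x b - (∑ a ∈ Icc 1 Q, x a / a) / (∑ a ∈ Icc 1 Q, (1 : ℝ) / a)) ^ 2 ≤
      (∑ b ∈ Icc 1 Q, (1 : ℝ) / b) * (mhi - mlo) ^ 2 := by
  have hH : 0 < ∑ a ∈ Icc 1 Q, (1 : ℝ) / a :=
    Finset.sum_pos (fun b hb => by have := (Finset.mem_Icc.1 hb).1; positivity) ⟨1, by simp [hQ]⟩
  set xbar := (∑ a ∈ Icc 1 Q, x a / a) / (∑ a ∈ Icc 1 Q, (1 : ℝ) / a) with hxbar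
  -- mlo ≤ x̄ ≤ mhi
  have hlo : mlo ≤ xbar := by
    rw [hxbar, le_div_iff₀ hH, Finset.mul_sum]
    refine Finset.sum_le_sum fun a ha => ?_
    have ha1 := (Finset.mem_Icc.1 ha).1
    have := (hx a ha1 (Finset.mem_Icc.1 ha).2).1
    calc mlo * (1 / (a : ℝ)) ≤ x a * (1 / (a : ℝ)) := mul_le_mul_of_nonneg_right this (by positivity)
      _ = x a / a := (div_eq_mul_one_div _ _).symm
  have hhi : xbar ≤ mhi := by
    rw [hxbar, div_le_iff₀ hH, Finset.mul_sum]
    refine Finset.sum_le_sum fun a ha => ?_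
    have ha1 := (Finset.mem_Icc.1 ha).1
    have := (hx a ha1 (Finset.mem_Icc.1 ha).2).2
    calc x a / a = x a * (1 / (a : ℝ)) := div_eq_mul_one_div _ _
      _ ≤ mhi * (1 / (a : ℝ)) := mul_le_mul_of_nonneg_right this (by positivity)
  rw [Finset.sum_mul]
  refine Finset.sum_le_sum fun b hb => ?_
  have hb1 := (Finset.mem_Icc.1 hb).1
  have hxb := hx b hb1 (Finset.mem_Icc.1 hb).2
  have habs : (x b - xbar) ^ 2 ≤ (mhi - mlo) ^ 2 := sq_le_sq' (by linarith) (by linarith)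
  exact mul_le_mul_of_nonneg_left habs (by positivity)

/-- **The flattened χ² of THEOREM B's cell is `≤ H_Q·(m_hi − m_lo)²`** (profile `T(b) = L/(log b + log p)`;
the set `(Icc 1 Q).filter p-free` of `window_functional_sq_le_atom_tilt` equals `Icc 1 Q` here, `bottom_filter_eq`). -/
theorem flat_chiSq_le {R p : ℕ} (hp : 3 ≤ p) (hpR : 2 * p ≤ R) (hR : R < p ^ 2) {A B c' Elo Ehi : ℝ}
    (hA1 : 1 ≤ A) (hΓU : ∀ x, R / p < x → x ≤ R → exitGamma R (R / p) x ≤ A * Real.log R / Real.log x)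
    (hB0 : 0 ≤ B) (hB1 : B ≤ 1)
    (hΓL : ∀ x, R / p < x → x ≤ R → B * Real.log R / Real.log x ≤ exitGamma R (R / p) x)
    (hψ : ∀ n, 1 ≤ n → n ≤ R → Real.log n - c' ≤ ∑ k ∈ Icc 1 n, vonMangoldt k / k)
    (hhi : ∀ n : ℕ, 1 ≤ n → ∑ k ∈ Icc 1 n, primeLogDiv k ≤ Real.log n + Ehi)
    (hlo : ∀ n : ℕ, 1 ≤ n → Real.log n - Elo ≤ ∑ k ∈ Icc 1 n, primeLogDiv k) :
    ∑ b ∈ Icc 1 (R / p), (b : ℝ) * (exitInflowAtom R (R / p) p b + Real.log R / (Real.log b + Real.log p) / b -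
        (∑ a ∈ Icc 1 (R / p), (exitInflowAtom R (R / p) p a + Real.log R / (Real.log a + Real.log p) / a)) /
          (∑ a ∈ Icc 1 (R / p), (1 : ℝ) / a) / b) ^ 2 ≤
      (∑ b ∈ Icc 1 (R / p), (1 : ℝ) / b) *
        ((A * Real.log R * (1 / Real.log (((R / p : ℕ) : ℝ) + 1) - 1 / Real.log R +
              (39 / 50 + c' + 2 * Real.log 2) / Real.log (((R / p : ℕ) : ℝ) + 1) ^ 2) +
            (1 - B) * Real.log R / Real.log p + B + B * Real.log R * (Elo + Ehi) / Real.log ((p - 1 : ℕ) : ℝ) ^ 2) -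
          (B * Real.log R * (1 / Real.log (2 * ((R / p : ℕ) : ℝ)) - 1 / (Real.log R - Real.log 2) -
                (39 / 50 + c' + Real.log 2) / Real.log (((R / p : ℕ) : ℝ) + 1) ^ 2) +
              A - (A - 1) * Real.log R / Real.log ((p - 1 : ℕ) : ℝ) -
              Real.log R * (Real.log p - Real.log ((p - 1 : ℕ) : ℝ)) / Real.log ((p - 1 : ℕ) : ℝ) ^ 2 -
              A * Real.log R * (Elo + Ehi) / Real.log ((p - 1 : ℕ) : ℝ) ^ 2)) ^ 2 := by
  have hQ1 : 1 ≤ R / p := (Nat.le_div_iff_mul_le (by omega)).2 (by omega)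
  set x : ℕ → ℝ := fun b => (b : ℝ) * exitInflowAtom R (R / p) p b + Real.log R / (Real.log b + Real.log p) with hxd
  have hx : ∀ b, 1 ≤ b → b ≤ R / p → _ ≤ x b ∧ x b ≤ _ := fun b hb hbQ =>
    ⟨le_flatDensity hp hpR hR hA1 hΓU hB0 hΓL hψ hhi hlo hb hbQ,
      flatDensity_le hp hpR hR hA1 hΓU hB0 hB1 hΓL hψ hhi hlo hb hbQ⟩
  have key := sum_inv_mul_sq_sub_mean_le hQ1 hx
  -- rewrite the χ² sum in terms of x
  have hmean : ∑ a ∈ Icc 1 (R / p), (exitInflowAtom R (R / p) p a + Real.log R / (Real.log a + Real.log p) / a) =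
      ∑ a ∈ Icc 1 (R / p), x a / a := by
    refine Finset.sum_congr rfl fun a ha => ?_
    have ha0 : (a : ℝ) ≠ 0 := by have := (Finset.mem_Icc.1 ha).1; positivity
    simp only [hxd]
    field_simp
  have hterms : ∀ b ∈ Icc 1 (R / p),
      (b : ℝ) * (exitInflowAtom R (R / p) p b + Real.log R / (Real.log b + Real.log p) / b -
        (∑ a ∈ Icc 1 (R / p), x a / a) / (∑ a ∈ Icc 1 (R / p), (1 : ℝ) / a) / b) ^ 2 =
      (1 / (b : ℝ)) * (x b - (∑ a ∈ Icc 1 (R / p), x a / a) / (∑ a ∈ Icc 1 (R / p), (1 : ℝ) / a)) ^ 2 := by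
    intro b hb
    have hb0 : (b : ℝ) ≠ 0 := by have := (Finset.mem_Icc.1 hb).1; positivity
    simp only [hxd]
    field_simp
  rw [hmean, Finset.sum_congr rfl hterms]
  exact key

end Summit.RiemannHypothesis.RiemannHypothesis.Theorems.IntegerScrew

end
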